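import Summits.HodgeConjecture.HodgeConjecture.Theses.PadicSemiregularLift
import Summits.HodgeConjecture.HodgeConjecture.Theorems.PadicSemiregularLiftHodgeBeyondAnchorsReductions
import Literature.AlgebraicGeometry.HodgeTheory.MotivatedClassesProofs
import Literature.AlgebraicGeometry.HodgeTheory.MotivatedClassesAlgebraic
import Literature.AlgebraicGeometry.HodgeTheory.MotivatedClassesAssembly
import Literature.AlgebraicGeometry.HodgeTheory.AlgebraicClassesPullbackOfCupProduct
import Literature.AlgebraicGeometry.HodgeTheory.LefschetzOneOneHolds
import Literature.AlgebraicGeometry.HodgeTheory.HardLefschetzNFoldHolds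
import Literature.AlgebraicGeometry.HodgeTheory.ComplexConjugationHolds

/-!
# `HodgeBeyondAnchors` (stmt-HodgeConjecture-14054): André's motivated split — the sorry-free glue

Route `PadicSemiregularLift` of `HodgeConjecture`, crux `HodgeBeyondAnchors` (the Hodge conjecture off
the two anchor classes; kernel-checked equivalent to the summit,
`Theorems/PadicSemiregularLiftHodgeBeyondAnchorsUnconditional.lean`). Line `andre-motivated-split`
(crux-strategist 2026-08-17, `Cruxes/HodgeBeyondAnchors/Lines/andre_motivated_split.lean`) splits the
PROPERTY "algebraic" along André's chain `A(X) ⊆ A_mot(X) ⊆ Hdg(X)` (Y. André, *Pour une théorie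
inconditionnelle des motifs*, Publ. Math. IHÉS 83 (1996), §0.3, Déf. 1, Thm 0.4, Thm 0.6.2) into

* (HM) every rational `(p,p)`-class in the deep middle `2 ≤ p ≤ n/2` of a smooth projective complex
  `n`-fold is MOTIVATED (`HodgeTheory.motivatedClasses`) — conjecture-grade, child `HodgeClassesMotivated`;
* (B) Grothendieck's standard conjecture of Lefschetz type in André's `*_L`-form for every smooth
  projective complex variety (`HodgeTheory.StandardConjectureBStar`) — conjecture-grade, child
  `LefschetzStandardB`;
* (Δ) pull-back along the diagonal `V ⟶ V ⊗ V` preserves `Nᵖ H²ᵖ` (Voisin II Prop. 9.21 (i) for the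
  diagonal) — a theorem in print, support child `DiagonalPullbackAlgebraic`; on the tree's coniveau
  carrier it is EQUIVALENT to the two unproved named facts `Voisin2003_cupProduct_algebraicClasses` and
  `fulton1998_map_mem_algebraicClasses` (`diagonalPullbackAlgebraic_iff_cupProduct`,
  `diagonalPullbackAlgebraic_iff_fulton1998` below, from `AlgebraicClassesPullbackOfCupProduct` and
  `AlgebraicClassesExteriorProduct`).

This file is the split GLUE, kernel-checked from tree theorems only (no `sorry`, no named-fact
hypothesis beyond the three displayed antecedents): `hodgeConjecture_of_motivated_of_standardConjectureB :
HM → B → Δ → HodgeConjecture` (Hodge models `nonempty_hodgeModel_holds`; reduction of the cycle part to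
the deep middle `cyclePart_of_deepMiddle` with the DISCHARGED Lefschetz `(1,1)`
`lefschetzOneOne_rational_holds` and hard Lefschetz `nonempty_hardLefschetzNFold_holds`; there HM gives
"motivated" and B + Δ give "motivated ⇒ algebraic",
`motivatedClasses_le_algebraicClasses_of_standardConjectureB_of_map_diagonal`), its restriction to the
crux `hodgeBeyondAnchors_of_motivated_of_standardConjectureB : HM → B → Δ → HodgeBeyondAnchors` (the
`--glue-by` declaration of the strategist's prepared `route edit --split HodgeBeyondAnchors`), and the
consistency direction `hodgeClassesMotivated_of_hodgeConjecture : HodgeConjecture → HM` (in all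
codimensions; André §2.1 "il est clair que `A_mot(X)` contient `A(X)`", the tree's
`algebraicClasses_le_motivatedClasses_of_nonempty_hardLefschetzNFold`), so HM is not refutable short of
refuting the summit. Nothing here claims HM or B.

References: Y. André, Publ. Math. IHÉS 83 (1996) §0.3 (pp. 7–8), §2.1 Déf. 1 and remark (p. 14),
Thm 0.6.2 (p. 9); C. Voisin, *Hodge Theory and Complex Algebraic Geometry II* (2003) §9.2.4
Prop. 9.20, Prop. 9.21 (i); W. Fulton, *Intersection Theory* (1998) §19.2 Cor. 19.2 (b);
A. Grothendieck, *Standard conjectures on algebraic cycles*, Bombay 1968, §3.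
-/

set_option linter.dupNamespace false

noncomputable section

open CategoryTheory AlgebraicGeometry MonoidalCategory CartesianMonoidalCategory
open Literature.AlgebraicTopology.SingularHomology Literature.Geometry.Kaehler
open Literature.AlgebraicGeometry.Motives Literature.AlgebraicGeometry.HodgeTheory

namespace Summit.HodgeConjecture.HodgeConjecture.Theorems.HodgeBeyondAnchors

open Summit.HodgeConjecture.HodgeConjecture.Theses.PadicSemiregularLift

/-! ## The support child (Δ) is the tree's cup-product / pull-back named fact -/

/-- **(Δ) ⟺ Voisin II Prop. 9.20 on the coniveau carrier.** "Pull-back along the diagonal of every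
smooth projective complex `V` preserves `Nᵖ H²ᵖ`" is equivalent to the named fact
`Voisin2003_cupProduct_algebraicClasses` (`Nᵃ H²ᵃ ∪ Nᵇ H²ᵇ ⊆ Nᵃ⁺ᵇ` on every smooth projective `V`):
`→` is the tree's `cupProduct_mem_algebraicClasses_of_forall_map_diagonal` (`a ∪ b = Δ^*(a × b)`, the
exterior product being algebraic unconditionally); `←` goes through Fulton's Cor. 19.2 (b)
(`fulton1998_map_mem_algebraicClasses_of_cupProduct`) applied to the morphism `Δ = (𝟙, 𝟙) : V ⟶ V ⊗ V`
of smooth projective varieties (`IsSmoothProjective.tensor_holds`).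
[cite: VoisinHodgeII2003, §9.2.4 proof of Prop. 9.20 and Prop. 9.21 (i)] -/
theorem diagonalPullbackAlgebraic_iff_cupProduct :
    (∀ ⦃d : ℕ⦄ ⦃V : SchemeOver ℂ⦄, IsSmoothProjective d V → ∀ (p : ℕ)
      ⦃c : complexBetti (V ⊗ V) (2 * p)⦄, c ∈ algebraicClasses (V ⊗ V) p →
        complexBetti.map (lift (𝟙 V) (𝟙 V)) (2 * p) c ∈ algebraicClasses V p) ↔
      Voisin2003_cupProduct_algebraicClasses := by
  refine ⟨fun hΔ _ _ hV _ _ _ _ hx hy ↦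
      cupProduct_mem_algebraicClasses_of_forall_map_diagonal hΔ hV _ _ hx hy, fun hcup _ _ hV p _ hc ↦ ?_⟩
  exact fulton1998_map_mem_algebraicClasses_of_cupProduct hcup (lift (𝟙 _) (𝟙 _))
    (IsSmoothProjective.tensor_holds hV hV) hV p _ hc

/-- **(Δ) ⟺ Fulton's Cor. 19.2 (b) on the coniveau carrier** (`fulton1998_map_mem_algebraicClasses`:
pull-back along EVERY morphism of smooth projective complex varieties preserves `Nᵖ H²ᵖ`): the
diagonal case is an instance, and conversely (Δ) gives Prop. 9.20 which gives Cor. 19.2 (b)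
(`fulton1998_map_mem_algebraicClasses_iff_cupProduct`). So the support child of the split is exactly
the tree's standing intersection-theory debt, in either of its two named forms.
[cite: Fulton1998, §19.2 Cor. 19.2 (b)] [cite: VoisinHodgeII2003, §9.2.4 Prop. 9.20 and Prop. 9.21 (i)] -/
theorem diagonalPullbackAlgebraic_iff_fulton1998 :
    (∀ ⦃d : ℕ⦄ ⦃V : SchemeOver ℂ⦄, IsSmoothProjective d V → ∀ (p : ℕ)
      ⦃c : complexBetti (V ⊗ V) (2 * p)⦄, c ∈ algebraicClasses (V ⊗ V) p →
        complexBetti.map (lift (𝟙 V) (𝟙 V)) (2 * p) c ∈ algebraicClasses V p) ↔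
      fulton1998_map_mem_algebraicClasses :=
  diagonalPullbackAlgebraic_iff_cupProduct.trans fulton1998_map_mem_algebraicClasses_iff_cupProduct.symm

/-! ## "`B` ⇒ motivated ⊆ algebraic" from (B) and (Δ) -/

/-- **André's §2.1 remark on the real carriers, from the two lower stubs**: under (B) for every smooth
projective complex variety and (Δ) for every diagonal, `A_motᵖ(X)_ℂ ⊆ Nᵖ H²ᵖ(X(ℂ); ℂ)` for every smooth
projective `X` and every `p` (the tree's PROVED reduction
`motivatedClasses_le_algebraicClasses_of_standardConjectureB_of_map_diagonal`).
[cite: Andre1996Motifs, §2.1 remark following Déf. 1 (p. 14)] -/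
theorem motivatedClasses_le_algebraicClasses_of_standardConjectureB_of_diagonal
    (hB : ∀ (d : ℕ) (Z : SchemeOver ℂ) (η : complexBetti Z 2), IsSmoothProjective d Z →
      StandardConjectureBStar d Z η)
    (hΔ : ∀ ⦃d : ℕ⦄ ⦃V : SchemeOver ℂ⦄, IsSmoothProjective d V → ∀ (p : ℕ)
      ⦃c : complexBetti (V ⊗ V) (2 * p)⦄, c ∈ algebraicClasses (V ⊗ V) p →
        complexBetti.map (lift (𝟙 V) (𝟙 V)) (2 * p) c ∈ algebraicClasses V p)
    {n : ℕ} {X : SchemeOver ℂ} (hX : IsSmoothProjective n X) (p : ℕ) :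
    motivatedClasses n X p ≤ algebraicClasses X p :=
  (motivatedClasses_le_algebraicClasses_of_standardConjectureB_of_map_diagonal hΔ) hB hX p

/-! ## The glue: HM → B → Δ → summit, and its restriction to the crux -/

/-- **The Hodge conjecture from André's split** (sorry-free glue, tree theorems only): if (HM) every
rational `(p,p)`-class in the deep middle `2 ≤ p`, `2p ≤ n` of every smooth projective complex
`n`-fold is motivated, (B) the Lefschetz involution of every smooth projective complex variety is an
algebraic correspondence, and (Δ) diagonal pull-back preserves `Nᵖ H²ᵖ`, then `HodgeConjecture`.
Proof: a Hodge model exists (`nonempty_hodgeModel_holds`, which USES `IsSmoothProjective n X` — the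
load-bearing hypothesis of `Negative/FalseWithoutIsSmoothProjective`); the cycle clause reduces to the
deep middle by Lefschetz `(1,1)` and hard Lefschetz (`cyclePart_of_deepMiddle` fed with the discharged
`lefschetzOneOne_rational_holds`, `nonempty_hardLefschetzNFold_holds`); there the class is motivated by
(HM) and algebraic by (B) + (Δ). This is André's §0.3 sentence "cette notion se réduit à celle de cycle
algébrique si pour tout objet de `𝒱` l'involution `*_L` est donnée par une correspondance algébrique"
composed with Déf. 1. [cite: Andre1996Motifs, §0.3 (pp. 7–8) and §2.1 Déf. 1 (p. 14)] -/
theorem hodgeConjecture_of_motivated_of_standardConjectureB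
    (hM : ∀ ⦃n : ℕ⦄ ⦃X : SchemeOver ℂ⦄, IsSmoothProjective n X →
      ∀ p : ℕ, 2 ≤ p → 2 * p ≤ n →
        ∀ c : complexBetti X (2 * p), IsRationalClass c → IsOfHodgeType n X (2 * p) p p c →
          c ∈ motivatedClasses n X p)
    (hB : ∀ (d : ℕ) (Z : SchemeOver ℂ) (η : complexBetti Z 2), IsSmoothProjective d Z →
      StandardConjectureBStar d Z η)
    (hΔ : ∀ ⦃d : ℕ⦄ ⦃V : SchemeOver ℂ⦄, IsSmoothProjective d V → ∀ (p : ℕ)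
      ⦃c : complexBetti (V ⊗ V) (2 * p)⦄, c ∈ algebraicClasses (V ⊗ V) p →
        complexBetti.map (lift (𝟙 V) (𝟙 V)) (2 * p) c ∈ algebraicClasses V p) :
    _root_.HodgeConjecture := by
  intro n X hX
  refine ⟨nonempty_hodgeModel_holds hX, ?_⟩
  refine cyclePart_of_deepMiddle lefschetzOneOne_rational_holds
    (nonempty_hardLefschetzNFold_holds n X) hX ?_
  intro p hp2 hpn c hc hpp
  exact motivatedClasses_le_algebraicClasses_of_standardConjectureB_of_diagonal hB hΔ hX p
    (hM hX p hp2 hpn c hc hpp)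

/-- **The crux from André's split** — the `--glue-by` declaration of the strategist's prepared
`route edit --split HodgeBeyondAnchors --into {HodgeClassesMotivated, LefschetzStandardB,
DiagonalPullbackAlgebraic}`: `HM → B → Δ → HodgeBeyondAnchors`, by restricting the glued summit
statement to non-anchors (the anchor exclusions are not load-bearing, `Cruxes/HodgeBeyondAnchors/Disproof.lean` §0).
The antecedents are verbatim the three registered stubs of line `andre-motivated-split`.
[cite: Andre1996Motifs, §0.3 (pp. 7–8)] -/
theorem hodgeBeyondAnchors_of_motivated_of_standardConjectureB :
    (∀ ⦃n : ℕ⦄ ⦃X : SchemeOver ℂ⦄, IsSmoothProjective n X →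
      ∀ p : ℕ, 2 ≤ p → 2 * p ≤ n →
        ∀ c : complexBetti X (2 * p), IsRationalClass c → IsOfHodgeType n X (2 * p) p p c →
          c ∈ motivatedClasses n X p) →
    (∀ (d : ℕ) (Z : SchemeOver ℂ) (η : complexBetti Z 2), IsSmoothProjective d Z →
      StandardConjectureBStar d Z η) →
    (∀ ⦃d : ℕ⦄ ⦃V : SchemeOver ℂ⦄, IsSmoothProjective d V → ∀ (p : ℕ)
      ⦃c : complexBetti (V ⊗ V) (2 * p)⦄, c ∈ algebraicClasses (V ⊗ V) p →
        complexBetti.map (lift (𝟙 V) (𝟙 V)) (2 * p) c ∈ algebraicClasses V p) →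
    Summit.HodgeConjecture.HodgeConjecture.Theses.PadicSemiregularLift.HodgeBeyondAnchors :=
  fun hM hB hΔ _ _ hX _ _ ↦ hodgeConjecture_of_motivated_of_standardConjectureB hM hB hΔ hX

/-- **With (Δ) replaced by the tree's named fact** `Voisin2003_cupProduct_algebraicClasses`
(equivalent to (Δ), `diagonalPullbackAlgebraic_iff_cupProduct`): `HM → B → Prop. 9.20 → HodgeBeyondAnchors`.
This is the form in which the support child is a standing Literature debt rather than a new item.
[cite: Andre1996Motifs, §0.3 (pp. 7–8)] [cite: VoisinHodgeII2003, §9.2.4 Prop. 9.20] -/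
theorem hodgeBeyondAnchors_of_motivated_of_standardConjectureB_of_cupProduct
    (hM : ∀ ⦃n : ℕ⦄ ⦃X : SchemeOver ℂ⦄, IsSmoothProjective n X →
      ∀ p : ℕ, 2 ≤ p → 2 * p ≤ n →
        ∀ c : complexBetti X (2 * p), IsRationalClass c → IsOfHodgeType n X (2 * p) p p c →
          c ∈ motivatedClasses n X p)
    (hB : ∀ (d : ℕ) (Z : SchemeOver ℂ) (η : complexBetti Z 2), IsSmoothProjective d Z →
      StandardConjectureBStar d Z η)
    (hcup : Voisin2003_cupProduct_algebraicClasses) : HodgeBeyondAnchors :=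
  hodgeBeyondAnchors_of_motivated_of_standardConjectureB hM hB
    (diagonalPullbackAlgebraic_iff_cupProduct.2 hcup)

/-! ## Consistency: (HM) is a consequence of the summit -/

/-- **(HM) in ALL codimensions follows from the Hodge conjecture**: algebraic classes are motivated
(André §2.1 "il est clair que `A_mot(X)_E` contient `A(X)`", the tree's PROVED
`algebraicClasses_le_motivatedClasses_of_nonempty_hardLefschetzNFold`, fed with the discharged hard
Lefschetz datum of `X ⊗ X`). Hence the child `HodgeClassesMotivated` is not refutable short of refuting
the summit: a non-motivated Hodge class is in particular a counterexample to the Hodge conjecture.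
[cite: Andre1996Motifs, §2.1 remark following Déf. 1 (p. 14)] -/
theorem hodgeClassesMotivated_of_hodgeConjecture (h : _root_.HodgeConjecture) :
    ∀ ⦃n : ℕ⦄ ⦃X : SchemeOver ℂ⦄, IsSmoothProjective n X →
      ∀ (p : ℕ) (c : complexBetti X (2 * p)), IsRationalClass c → IsOfHodgeType n X (2 * p) p p c →
        c ∈ motivatedClasses n X p := by
  intro n X hX p c hc hpp
  exact algebraicClasses_le_motivatedClasses_of_nonempty_hardLefschetzNFold hX
    (nonempty_hardLefschetzNFold_holds (n + n) (X ⊗ X)) p ((h hX).2 p c hc hpp)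

/-- The deep-middle form of (HM) — verbatim the registered stub `stub_hodgeClassesMotivated` — from the
summit (restriction of `hodgeClassesMotivated_of_hodgeConjecture`). [cite: Andre1996Motifs, §2.1 remark following Déf. 1 (p. 14)] -/
theorem hodgeClassesMotivated_deepMiddle_of_hodgeConjecture (h : _root_.HodgeConjecture) :
    ∀ ⦃n : ℕ⦄ ⦃X : SchemeOver ℂ⦄, IsSmoothProjective n X →
      ∀ p : ℕ, 2 ≤ p → 2 * p ≤ n →
        ∀ c : complexBetti X (2 * p), IsRationalClass c → IsOfHodgeType n X (2 * p) p p c →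
          c ∈ motivatedClasses n X p :=
  fun _ _ hX p _ _ c hc hpp ↦ hodgeClassesMotivated_of_hodgeConjecture h hX p c hc hpp

/-- The same from the CRUX instead of the summit (the crux is summit-complete:
`HodgeBeyondAnchors → HodgeConjecture` by `X ↦ X × ℙ¹ × ℙ¹`, the tree's unconditional
`hodgeBeyondAnchors_iff_hodgeConjecture_holds` is not imported here to keep the import cone small, so
this is stated from the summit form `hodgeConjecture_iff_anchors_and_beyond` granted the two anchors).
[cite: Andre1996Motifs, §2.1 remark following Déf. 1 (p. 14)] -/
theorem hodgeClassesMotivated_of_anchors_and_beyond (h₁ : HodgeAbelianVarieties)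
    (h₂ : HodgeFermatVarieties) (h₃ : HodgeBeyondAnchors) :
    ∀ ⦃n : ℕ⦄ ⦃X : SchemeOver ℂ⦄, IsSmoothProjective n X →
      ∀ (p : ℕ) (c : complexBetti X (2 * p)), IsRationalClass c → IsOfHodgeType n X (2 * p) p p c →
        c ∈ motivatedClasses n X p :=
  hodgeClassesMotivated_of_hodgeConjecture (hodgeConjecture_iff_anchors_and_beyond.2 ⟨h₁, h₂, h₃⟩)

end Summit.HodgeConjecture.HodgeConjecture.Theorems.HodgeBeyondAnchors

end
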